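import Mathlib

/-!
# SoloBlind: the polynomial identities behind THEOREM Φ(i)

THEOREM Φ (side line O1b, `paper/theoremPhi.md` §2–§3) computes the all-plus Eisenstein part of
the component group of the Shimura-curve Jacobian `J^{Mw}` at `w` from the `2 × 2` operator
matrix `Δ = ((w+1, T_w), (T_w, w+1))` (degeneracy maps composed with their adjoints), the
intertwiners `u = ((0, w), (-1, T_w))`, `u' = ((T_w, w), (-1, 0))` describing `U_w` on the old
part, and the Hensel roots `ρ₁ + ρ_w = T_w`, `ρ₁ ρ_w = w` of `Z² − T_w Z + w` in the completed
Hecke algebra.  The proof of part (i) consists of the following identities in a commutative ring,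
recorded here so that the computational core of the prose proof is kernel-checked:

* `u Δ = Δ u'` (so `Δ` maps `u'`-eigenmodules to `u`-eigenmodules);
* on the `u'`-eigenline `(−ρ y, y)`, `Δ` is multiplication by `d_ρ = (w+1) − T ρ` followed by the
  parametrisation `z ↦ ((T−ρ) z, z)` of the `u`-eigenline, and `d_ρ = 1 − ρ²`;
* `(1 − ρ₁)(1 − ρ_w) = −η_w` with `η_w = T_w − w − 1`, and `1 − ρ² = (1 − ρ)(1 + ρ)` is a unit when
  both factors are;
* the two eigenlines span: `det ((ρ_w, ρ₁), (1, 1)) = ρ_w − ρ₁`.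
-/

namespace Summit.Langlands.Langlands.Theorems

open Matrix

variable {R : Type*} [CommRing R]

/-- The degeneracy intertwining relation `u Δ = Δ u'`. -/
theorem soloBlind_phi_intertwine (T w : R) :
    !![0, w; -1, T] * !![w + 1, T; T, w + 1] = !![w + 1, T; T, w + 1] * !![T, w; -1, 0] := by
  ext i j
  fin_cases i <;> fin_cases j <;> simp [Matrix.mul_apply, Fin.sum_univ_two] <;> ring

/-- `u`-eigenvectors: if `ρ² = Tρ − w` then `((T − ρ) y, y)` is a `u`-eigenvector for `ρ`. -/
theorem soloBlind_phi_u_eigen (T w ρ y : R) (h : ρ ^ 2 = T * ρ - w) :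
    !![0, w; -1, T] *ᵥ ![(T - ρ) * y, y] = ρ • ![(T - ρ) * y, y] := by
  ext i
  fin_cases i
  · simp [Matrix.mulVec, dotProduct, Fin.sum_univ_two]
    linear_combination y * h
  · simp [Matrix.mulVec, dotProduct, Fin.sum_univ_two]
    ring

/-- `u'`-eigenvectors: if `ρ² = Tρ − w` then `(−ρ y, y)` is a `u'`-eigenvector for `ρ`. -/
theorem soloBlind_phi_u'_eigen (T w ρ y : R) (h : ρ ^ 2 = T * ρ - w) :
    !![T, w; -1, 0] *ᵥ ![-ρ * y, y] = ρ • ![-ρ * y, y] := by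
  ext i
  fin_cases i
  · simp [Matrix.mulVec, dotProduct, Fin.sum_univ_two]
    linear_combination y * h
  · simp [Matrix.mulVec, dotProduct, Fin.sum_univ_two]

/-- `Δ` on the `u'`-eigenline: `Δ (−ρ y, y) = ((T − ρ) z, z)` with `z = ((w+1) − Tρ) y`. -/
theorem soloBlind_phi_Delta_eigen (T w ρ y : R) (h : ρ ^ 2 = T * ρ - w) :
    !![w + 1, T; T, w + 1] *ᵥ ![-ρ * y, y]
      = ![(T - ρ) * (((w + 1) - T * ρ) * y), ((w + 1) - T * ρ) * y] := by
  ext i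
  fin_cases i
  · simp [Matrix.mulVec, dotProduct, Fin.sum_univ_two]
    linear_combination (-(T * y)) * h
  · simp [Matrix.mulVec, dotProduct, Fin.sum_univ_two]
    ring

/-- The multiplier on the eigenline: `d_ρ = (w+1) − Tρ = 1 − ρ²`. -/
theorem soloBlind_phi_d_eq (T w ρ : R) (h : ρ ^ 2 = T * ρ - w) :
    (w + 1) - T * ρ = 1 - ρ ^ 2 := by
  linear_combination h

/-- Vieta: `(1 − ρ₁)(1 − ρ_w) = −η_w`, `η_w = T − w − 1`. -/
theorem soloBlind_phi_eta_factor (T w ρ₁ ρ₂ : R) (hs : ρ₁ + ρ₂ = T) (hp : ρ₁ * ρ₂ = w) :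
    (1 - ρ₁) * (1 - ρ₂) = -(T - w - 1) := by
  linear_combination (-1 : R) * hs + hp

/-- `1 − ρ²` is a unit as soon as `1 − ρ` and `1 + ρ` are (the case `w ≢ ±1 (mod ℓ)` for `ρ_w ≡ w`). -/
theorem soloBlind_phi_d_unit (ρ : R) (h1 : IsUnit (1 - ρ)) (h2 : IsUnit (1 + ρ)) :
    IsUnit (1 - ρ ^ 2) := by
  have : (1 : R) - ρ ^ 2 = (1 - ρ) * (1 + ρ) := by ring
  rw [this]
  exact h1.mul h2

/-- The two eigenlines span `X²` when `ρ_w − ρ₁` is a unit: the change-of-basis determinant. -/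
theorem soloBlind_phi_basis_det (ρ₁ ρ₂ : R) : !![ρ₂, ρ₁; 1, 1].det = ρ₂ - ρ₁ := by
  simp [Matrix.det_fin_two_of]

/-- Numerical instance from the data (`M = 66`, `ℓ = 5`, `w = 7`, `T_w ≡ 8`, roots `1, 7 ≡ 2`
modulo `5`): in `ZMod 5`, `ρ = 2` satisfies `ρ² = 8ρ − 7` and `d_ρ = 8 − 8·2 = 1 − 4`. -/
example : ((7 : ZMod 5) + 1) - 8 * 2 = 1 - 2 ^ 2 :=
  soloBlind_phi_d_eq (8 : ZMod 5) 7 2 (by decide)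

end Summit.Langlands.Langlands.Theorems
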